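import Summits.Ventures.HSemireg.WedgeHankelGlue

/-!
# Venture HSemireg — duality of wedge ranks: degree m versus the mirror degree

HONEST FRAMING. Part of the Lean index of the computation cell `pub-hsemireg` (second enclosure wave, cut by seat p6 in the
conventions of seat p3's ENCLOSURE-PLAN-p3.md / build.py from th-7's kernel assets).  Finite-dimensional exterior algebra over a field ONLY:
no variety, no cohomology theory, no semiregularity map is constructed here; nothing here says that HC / HC_CM / HC_AV holds;
no Literature fact is declared or used.  The geometric DICTIONARY (why these ranks are the `HT`-side box ranks of the cell's
STRUCTURE.md §1 / theory/FORMULA-N.md) lives in theory/FORMULA-N-th7.md PART B §A.3 / §N and is NOT asserted in Lean.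

th-7's PART D — DUALITY OF WEDGE RANKS (theory/th7/WeilPurity.lean v3.2 sha256/16 fa4f1543e639b652 (th-7 g5, 22:21Z 2026-08-22; ×2 farm rc 0 + axioms standard at p3 g9 21:58Z (v3.1 prefix), th-2 g22 22:27Z, p6 g7 22:32Z; statement reads + independent exact numerics p6 g6 X2-WEILPURITY-p6g6.md a0873432c5a1b400 (PART W 105/105, PART D 704/704) and p6 g7 X2-WEILPURITY-E-p6g7.md 6348f244af71037e (PART E 216/216)), l.6717–6933), VERBATIM up to the namespace
(`HSemiregHankel` ↦ `Summit.Ventures.HSemireg.Wedge.Hankel`, which sees the wedge-model infrastructure `….Wedge`): for `v` homogeneous of degree `d` in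
`⋀(K^I)` and `m + d + m' = |I|`, the coordinate matrix `cmat v (m+d) m` of `S ↦ E_S ∧ v` is, up to invertible diagonal ROW / COLUMN scalings by structure-constant
units and one global sign, the TRANSPOSE of `cmat v (m'+d) m'` reindexed by complements (`cmat_entry_dual`, `rank_cmat_dual`); hence
**`finrank_range_wedge_dual`**: `dim range(θ ↦ θ ∧ v ∣ ⋀^m) = dim range(θ ↦ θ ∧ v ∣ ⋀^{m'})` on `⋀(K^{2n})` (every field, every `n`).  New names `Psc`, `Φc`,
`cmat`, `cpl`, `cplEquiv` (no clash with the tree).  ×2 p6 g6 (statement read + exact numerics 704/704, X2-WEILPURITY-p6g6.md) and p3 g9 (farm).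
The corollaries for THEOREM R-B's class (mirror degrees) are `WedgeWeilMirror.lean`.
-/

open Module Set Set.powersetCard

namespace Summit.Ventures.HSemireg.Wedge

variable (K : Type*) [Field K] {I : Type*} [LinearOrder I] [Fintype I]

/-- `Hom D d * Hom D d' ⊆ Hom D (d + d')`-type closure used for `θ * w`. -/
lemma mul_mem_Hom {D : Finset I} {d d' : ℕ} {v w : HT K I} (hv : v ∈ Hom K I D d) (hw : w ∈ Hom K I D d') :
    v * w ∈ Hom K I D (d + d') := by
  induction hv, hw using Submodule.span_induction₂ with
  | mem_mem x y hx hy =>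
    obtain ⟨a, ha, rfl⟩ := hx
    obtain ⟨c, hc, rfl⟩ := hy
    rw [B_mul_B]
    by_cases hac : Disjoint a c
    · refine Submodule.smul_mem _ _ (B_mem_Hom K (Finset.union_subset ha.1 hc.1) ?_)
      rw [Finset.card_union_of_disjoint hac, ha.2, hc.2]
    · rw [u_eq_zero K hac, zero_smul]; exact Submodule.zero_mem _
  | zero_left y _ => rw [zero_mul]; exact Submodule.zero_mem _
  | zero_right x _ => rw [mul_zero]; exact Submodule.zero_mem _
  | add_left x y z _ _ _ hx hy => rw [add_mul]; exact Submodule.add_mem _ hx hy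
  | add_right x y z _ _ _ hx hy => rw [mul_add]; exact Submodule.add_mem _ hx hy
  | smul_left r x y _ _ hx => rw [smul_mul_assoc]; exact Submodule.smul_mem _ _ hx
  | smul_right r x y _ _ hx => rw [mul_smul_comm]; exact Submodule.smul_mem _ _ hx

/-! ### Coordinates of products and injectivity of multiplication by a disjoint monomial -/

end Summit.Ventures.HSemireg.Wedge

/-! ## PART D — DUALITY `rank(θ ↦ θ ∧ v ∣ ⋀^m) = rank(θ ↦ θ ∧ v ∣ ⋀^{m'})`, `v` homogeneous of degree `d`,
`m + d + m' = |I|` (th-7 g5 = literature-prover-pub-hsemireg-th-7-g5-0, 2026-08-22).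
The coordinate matrix of `S ↦ E_S ∧ v` in degree `m` is the TRANSPOSE of the one in degree `m'`, reindexed by
complements, up to a ROW scaling and a COLUMN scaling by structure constants `u(U,Uᶜ)⁻¹`, `u(Sᶜ,S)` (units whose
values are never used) and one global sign: both scaled entries are the top coefficient of `E_S · v · E_{Uᶜ}`
(associativity + parity-only graded commutativity). Consequence for the cell: every rank theorem stated for
degrees `m < n` (THEOREM R-B `weilRank_nn_deg`, …) holds verbatim in the mirror degree `2n − m`, and the
degree-`n` purity locus is self-dual. Nothing here bears on HC / HC_CM / HC_AV. -/

namespace Summit.Ventures.HSemireg.Wedge.Hankel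

section Dual

variable (K : Type*) [Field K] {I : Type*} [LinearOrder I] [Fintype I]

variable (I) in
/-- monomials (index sets) of cardinality `k`, as a type -/
abbrev Psc (k : ℕ) : Type _ := {U : Finset I // U.card = k}

variable (I) in
/-- the coordinate functionals of the cardinality-`k` monomials, bundled into one linear map -/
noncomputable def Φc (k : ℕ) : HT K I →ₗ[K] (Psc I k → K) :=
  LinearMap.pi fun U => (B K I).coord (U : Finset I)

variable (I) in
/-- coordinate matrix of `S ↦ E_S * v`: rows = monomials of cardinality `k`, columns = monomials of cardinality `m` -/
noncomputable def cmat (v : HT K I) (k m : ℕ) : Matrix (Psc I k) (Psc I m) K :=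
  Matrix.of fun U S => (B K I).coord (U : Finset I) (B K I (S : Finset I) * v)

/-- entries of the coordinate matrix: `cmat v k m U S = coord_U (E_S · v)` (definitional). -/
lemma cmat_apply (v : HT K I) (k m : ℕ) (U : Psc I k) (S : Psc I m) :
    cmat K I v k m U S = (B K I).coord (U : Finset I) (B K I (S : Finset I) * v) := rfl

/-- coordinates of a homogeneous element vanish off its degree -/
lemma coord_eq_zero_of_mem_Hom {D : Finset I} {d : ℕ} {w : HT K I} (hw : w ∈ Hom K I D d) {t : Finset I}
    (ht : t.card ≠ d) : (B K I).coord t w = 0 := by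
  classical
  induction hw using Submodule.span_induction with
  | mem x hx =>
    obtain ⟨s, hs, rfl⟩ := hx
    rw [Basis.coord_apply, Basis.repr_self, Finsupp.single_apply, if_neg]
    rintro rfl; exact ht hs.2
  | zero => simp
  | add x y _ _ hx hy => rw [map_add, hx, hy, add_zero]
  | smul a x _ hx => rw [map_smul, hx, smul_zero]

/-- a homogeneous element of degree `d` with all degree-`d` coordinates zero is zero. -/
lemma eq_zero_of_coord_card {d : ℕ} {w : HT K I} (hw : w ∈ Hom K I Finset.univ d)
    (h : ∀ t : Finset I, t.card = d → (B K I).coord t w = 0) : w = 0 := by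
  apply (B K I).repr.injective
  rw [map_zero]
  ext t
  by_cases ht : t.card = d
  · exact h t ht
  · exact coord_eq_zero_of_mem_Hom K hw ht

/-- the bundled degree-`k` coordinate map is injective on the homogeneous part of degree `k`. -/
lemma Φc_eq_zero {k : ℕ} {w : HT K I} (hw : w ∈ Hom K I Finset.univ k) (h : Φc K I k w = 0) : w = 0 :=
  eq_zero_of_coord_card K hw fun t ht => by simpa [Φc] using congr_fun h ⟨t, ht⟩

/-- the span of the `E_S · v`, `|S| = m`, is the image of the degree-`m` part under right multiplication by `v`. -/
lemma span_range_B_mul (v : HT K I) (m : ℕ) :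
    Submodule.span K (Set.range fun S : Psc I m => B K I (S : Finset I) * v) =
      (Hom K I Finset.univ m).map (LinearMap.mulRight K v) := by
  rw [Hom, Submodule.map_span, ← Set.image_comp]
  congr 1
  ext x
  simp only [Set.mem_range, Set.mem_image, Function.comp_apply, Set.mem_setOf_eq, Finset.subset_univ,
    true_and, LinearMap.mulRight_apply]
  constructor
  · rintro ⟨S, rfl⟩
    exact ⟨S, S.2, rfl⟩
  · rintro ⟨s, hs, rfl⟩
    exact ⟨⟨s, hs⟩, rfl⟩

/-- the rank of the coordinate matrix is the dimension of `(Hom_m) · v` -/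
lemma rank_cmat (v : HT K I) {d : ℕ} (hv : v ∈ Hom K I Finset.univ d) (m : ℕ) :
    (cmat K I v (m + d) m).rank =
      Module.finrank K ((Hom K I Finset.univ m).map (LinearMap.mulRight K v)) := by
  have hcol : (cmat K I v (m + d) m).col = ⇑(Φc K I (m + d)) ∘ (fun S : Psc I m => B K I (S : Finset I) * v) := by
    funext S U
    rfl
  rw [Matrix.rank_eq_finrank_span_cols, hcol, Set.range_comp, ← Submodule.map_span, span_range_B_mul,
    finrank_map_of_injOn K (Φc K I (m + d)) _ ?_]
  intro x hx h0
  have hx' : x ∈ Hom K I Finset.univ (m + d) := by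
    obtain ⟨y, hy, rfl⟩ := hx
    exact mul_mem_Hom K hy hv
  exact Φc_eq_zero K hx' h0

/-- top coefficient of `E_{U'} · E_{Uᶜ}` for `|U'| = |U|`: the unit `u(U,Uᶜ)` on the diagonal, `0` off it -/
lemma coord_univ_B_mul_B_compl {U U' : Finset I} (h : U'.card = U.card) :
    (B K I).coord Finset.univ (B K I U' * B K I Uᶜ) = if U' = U then u K U Uᶜ else 0 := by
  classical
  rw [B_mul_B]
  by_cases hU : U' = U
  · subst hU
    rw [if_pos rfl, Finset.union_compl, map_smul, Basis.coord_apply, Basis.repr_self,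
      Finsupp.single_eq_same, smul_eq_mul, mul_one]
  · rw [if_neg hU]
    have hd : ¬ Disjoint U' Uᶜ := by
      intro hdis
      apply hU
      exact Finset.eq_of_subset_of_card_le (disjoint_compl_right_iff.mp hdis) h.ge
    rw [u_eq_zero K hd, zero_smul, map_zero]

/-- top coefficient of `x · E_{Uᶜ}` for `x` homogeneous of degree `|U|` = `u(U,Uᶜ) · (coefficient of E_U in x)` -/
lemma coord_univ_mul_B_compl {k : ℕ} {x : HT K I} (hx : x ∈ Hom K I Finset.univ k) {U : Finset I}
    (hU : U.card = k) :
    (B K I).coord Finset.univ (x * B K I Uᶜ) = u K U Uᶜ * (B K I).coord U x := by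
  classical
  induction hx using Submodule.span_induction with
  | mem y hy =>
    obtain ⟨U', hU', rfl⟩ := hy
    rw [coord_univ_B_mul_B_compl K (hU'.2.trans hU.symm), Basis.coord_apply, Basis.repr_self,
      Finsupp.single_apply]
    by_cases h : U' = U
    · rw [if_pos h, if_pos h, mul_one]
    · rw [if_neg h, if_neg h, mul_zero]
  | zero => simp
  | add y z _ _ hy hz => rw [add_mul, map_add, hy, hz, map_add, mul_add]
  | smul a y _ hy => rw [smul_mul_assoc, map_smul, hy, map_smul, smul_eq_mul, smul_eq_mul, mul_left_comm]

/-- complement, as a map between monomial types -/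
def cpl {a b : ℕ} (h : a + b = Fintype.card I) (S : Psc I a) : Psc I b :=
  ⟨(S : Finset I)ᶜ, by rw [Finset.card_compl, S.2]; omega⟩

/-- the complement map on monomials takes the set complement (definitional). -/
@[simp] lemma coe_cpl {a b : ℕ} (h : a + b = Fintype.card I) (S : Psc I a) :
    ((cpl h S : Psc I b) : Finset I) = (S : Finset I)ᶜ := rfl

/-- complement, as an equivalence between monomial types -/
def cplEquiv {a b : ℕ} (h : a + b = Fintype.card I) : Psc I a ≃ Psc I b where
  toFun := cpl h
  invFun := cpl (by omega)
  left_inv S := Subtype.ext (compl_compl (S : Finset I))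
  right_inv S := Subtype.ext (compl_compl (S : Finset I))

/-- the complement equivalence acts by `cpl` (definitional). -/
@[simp] lemma cplEquiv_apply {a b : ℕ} (h : a + b = Fintype.card I) (S : Psc I a) :
    cplEquiv h S = cpl h S := rfl

/-- THE ENTRY IDENTITY: `cmat_{U,S}` in degree `m` = row unit × `cmat_{Sᶜ,Uᶜ}` in degree `m'` × column unit -/
lemma cmat_entry_dual {d m m' : ℕ} (hI : m + d + m' = Fintype.card I) {v : HT K I}
    (hv : v ∈ Hom K I Finset.univ d) (U : Psc I (m + d)) (S : Psc I m) :
    cmat K I v (m + d) m U S =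
      ((-1 : K) ^ (m * (d + m') + m' * d) * (u K (U : Finset I) (U : Finset I)ᶜ)⁻¹) *
        cmat K I v (m' + d) m' (cpl (show m + (m' + d) = Fintype.card I by omega) S)
          (cpl (show (m + d) + m' = Fintype.card I by omega) U) *
        u K ((S : Finset I)ᶜ) (S : Finset I) := by
  classical
  have hUc : ((U : Finset I)ᶜ).card = m' := by rw [Finset.card_compl, U.2]; omega
  have hSc : ((S : Finset I)ᶜ).card = m' + d := by rw [Finset.card_compl, S.2]; omega
  -- the common value: top coefficient of (v · E_{Uᶜ}) · E_S
  set T := (B K I).coord Finset.univ (v * B K I (U : Finset I)ᶜ * B K I (S : Finset I)) with hT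
  have hy : v * B K I (U : Finset I)ᶜ ∈ Hom K I Finset.univ (d + m') := by
    have := mul_B_mem_Hom K (Finset.Subset.refl _) (Finset.subset_univ ((U : Finset I)ᶜ)) hv
    rwa [hUc] at this
  have h1 : u K (U : Finset I) (U : Finset I)ᶜ * cmat K I v (m + d) m U S = (-1 : K) ^ (m * (d + m')) * T := by
    rw [cmat_apply, ← coord_univ_mul_B_compl K (mul_mem_Hom K (B_mem_Hom K (Finset.subset_univ _) S.2) hv) U.2,
      mul_assoc, B_mul_comm_of_mem_Hom K hy, S.2, map_smul, smul_eq_mul]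
  have h2 : u K ((S : Finset I)ᶜ) (S : Finset I) *
      cmat K I v (m' + d) m' (cpl (show m + (m' + d) = Fintype.card I by omega) S)
        (cpl (show (m + d) + m' = Fintype.card I by omega) U) = (-1 : K) ^ (m' * d) * T := by
    have hx : B K I (U : Finset I)ᶜ * v ∈ Hom K I Finset.univ (m' + d) :=
      mul_mem_Hom K (B_mem_Hom K (Finset.subset_univ _) hUc) hv
    have h3 := coord_univ_mul_B_compl K hx hSc
    rw [compl_compl] at h3
    rw [cmat_apply, coe_cpl, coe_cpl, ← h3, B_mul_comm_of_mem_Hom K hv, hUc, smul_mul_assoc, map_smul,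
      smul_eq_mul]
  have huU : u K (U : Finset I) (U : Finset I)ᶜ ≠ 0 := (u_ne_zero_iff K).mpr disjoint_compl_right
  have hε : ((-1 : K) ^ (m' * d)) * ((-1 : K) ^ (m' * d)) = 1 := by
    rw [← pow_add, ← two_mul, pow_mul, neg_one_sq, one_pow]
  have e1 : cmat K I v (m + d) m U S = (u K (U : Finset I) (U : Finset I)ᶜ)⁻¹ * ((-1 : K) ^ (m * (d + m')) * T) := by
    rw [← h1, inv_mul_cancel_left₀ huU]
  have e2 : T = (-1 : K) ^ (m' * d) * (u K ((S : Finset I)ᶜ) (S : Finset I) *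
      cmat K I v (m' + d) m' (cpl (show m + (m' + d) = Fintype.card I by omega) S)
        (cpl (show (m + d) + m' = Fintype.card I by omega) U)) := by
    rw [h2, ← mul_assoc, hε, one_mul]
  rw [e1, e2, pow_add]
  ring

/-- DUALITY OF THE COORDINATE MATRICES: equal rank in degrees `m` and `m'` whenever `m + d + m' = |I|` -/
theorem rank_cmat_dual {d m m' : ℕ} (hI : m + d + m' = Fintype.card I) {v : HT K I}
    (hv : v ∈ Hom K I Finset.univ d) :
    (cmat K I v (m + d) m).rank = (cmat K I v (m' + d) m').rank := by
  classical
  have hM : cmat K I v (m + d) m =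
      Matrix.diagonal (fun U : Psc I (m + d) =>
          (-1 : K) ^ (m * (d + m') + m' * d) * (u K (U : Finset I) (U : Finset I)ᶜ)⁻¹) *
        Matrix.transpose ((cmat K I v (m' + d) m').submatrix
            (cplEquiv (show m + (m' + d) = Fintype.card I by omega))
            (cplEquiv (show (m + d) + m' = Fintype.card I by omega))) *
        Matrix.diagonal (fun S : Psc I m => u K ((S : Finset I)ᶜ) (S : Finset I)) := by
    ext U S
    simp only [Matrix.mul_diagonal, Matrix.diagonal_mul, Matrix.transpose_apply, Matrix.submatrix_apply,
      cplEquiv_apply]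
    exact cmat_entry_dual K hI hv U S
  have hr : IsUnit (Matrix.diagonal (fun U : Psc I (m + d) =>
      (-1 : K) ^ (m * (d + m') + m' * d) * (u K (U : Finset I) (U : Finset I)ᶜ)⁻¹)).det := by
    rw [Matrix.det_diagonal, isUnit_iff_ne_zero, Finset.prod_ne_zero_iff]
    intro U _
    exact mul_ne_zero (pow_ne_zero _ (neg_ne_zero.mpr one_ne_zero))
      (inv_ne_zero ((u_ne_zero_iff K).mpr disjoint_compl_right))
  have hc : IsUnit (Matrix.diagonal (fun S : Psc I m => u K ((S : Finset I)ᶜ) (S : Finset I))).det := by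
    rw [Matrix.det_diagonal, isUnit_iff_ne_zero, Finset.prod_ne_zero_iff]
    intro S _
    exact (u_ne_zero_iff K).mpr disjoint_compl_left
  rw [hM, Matrix.rank_mul_eq_left_of_isUnit_det _ _ hc, Matrix.rank_mul_eq_right_of_isUnit_det _ _ hr,
    Matrix.rank_transpose, Matrix.rank_submatrix]

end Dual

/-- **DUALITY OF WEDGE RANKS** (every field, every `n`): for `v ∈ ⋀^d (K^{2n})` and `m + d + m' = 2n`,
`dim range(θ ↦ θ ∧ v ∣ ⋀^m) = dim range(θ ↦ θ ∧ v ∣ ⋀^{m'})`. -/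
theorem finrank_range_wedge_dual (K : Type*) [Field K] {n d m m' : ℕ} (h : m + d + m' = n + n)
    {v : HT K (In n)} (hv : v ∈ Hom K (In n) Finset.univ d) :
    Module.finrank K (LinearMap.range (wedge K n m v)) =
      Module.finrank K (LinearMap.range (wedge K n m' v)) := by
  have hI : m + d + m' = Fintype.card (In n) := by rw [h, Fintype.card_fin]
  rw [range_wedge, range_wedge, ← rank_cmat K v hv m, ← rank_cmat K v hv m', rank_cmat_dual K hI hv]

end Summit.Ventures.HSemireg.Wedge.Hankel
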